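import Literature.AnabelianGeometry.AbsoluteAnabelian.ProfiniteSlimAscent
import Mathlib.GroupTheory.OrderOfElement
import HarnessLib

/-!
# No finite normal subgroups from a torsion-free normal subgroup with trivial centraliser ([AbsTopI] §0, Prop 2.3 (i))

S. Mochizuki, *Topics in Absolute Anabelian Geometry I: Generalities* (2012) [AbsTopI] (lit key
`paper:url-11ac98ba15fc`), §0 p. 8 ("every finite normal closed subgroup `N ⊆ G` of a slim profinite group `G`
is trivial") and Prop 2.3 (i) p. 19 (an almost pro-`Σ` group of GFG-type is slim and elastic).  The tree proves
slimness + elasticity of such a `Δ` from an open slim elastic subgroup MODULO the hypothesis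
(FN) «`Δ` has no nontrivial finite normal subgroup» (`ProfiniteSlimAscent.lean`, p433420,
`isSlimGroup_of_isOpen_slim_of_forall_finite_normal_eq_bot`; (FN) is necessary there: `U × F`).

This PROOF-ONLY file (no definition, no named fact) replaces (FN) by a hypothesis of the shape geometric origin
supplies (abc-iut L4 board, RULING #7n (β) / #7o «P23i-FN-ABSTRACT»):

* `inf_eq_bot_of_finite_of_forall_isOfFinOrder_eq_one` — a finite subgroup meets a torsion-free subgroup
  trivially ("torsion-free" in print's sense: no nontrivial element of finite order);
* **`finite_normal_eq_bot_of_torsionFree_of_centralizer_eq_bot`** — for ANY group `Δ` with a NORMAL subgroup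
  `U` that is torsion-free and has TRIVIAL CENTRALISER `Z_Δ(U) = 1`, every finite normal subgroup `F ⊴ Δ` is
  trivial: `F ∩ U = 1` (torsion-free), and for `f ∈ F`, `u ∈ U` the commutator `f u f⁻¹ u⁻¹` lies in
  `F ∩ U` (both normal), so `f ∈ Z_Δ(U) = 1`.  No topology and no openness is needed for this step;
  `'`-variant with Mathlib's `[IsMulTorsionFree U]`;
* `centralizer_eq_bot_iff_mem_of_conj_eq_conj` — the centraliser hypothesis in OUTER form: for `U ⊴ Δ` with
  trivial centre (e.g. `U` slim), `Z_Δ(U) = 1` iff «an element of `Δ` acting on `U` as an inner automorphism of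
  `U` lies in `U`», i.e. `Δ/U → Out(U)` is injective;
* corollaries composing with p433420 / p432240: `isSlimGroup_of_isOpen_slim_of_torsionFree_of_centralizer_eq_bot`,
  `slim_and_elastic_of_isOpen_of_torsionFree_of_centralizer_eq_bot`, and the packaging
  `FundamentalExtension.geomSlimElastic_of_isOpen_of_torsionFree_of_centralizer_eq_bot` for the node
  predicate of [AbsTopI] Prop 2.3 (i) — so that (FN) is replaced by «`U^Σ` torsion-free ∧ `Z_Δ(U^Σ) = 1`».

RESIDUAL GEOMETRIC LEAF (named here, NOT proved and NOT typed as a fact): for `Δ = Δ_X` almost pro-`Σ` of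
GFG-type and `U^Σ ⊴ Δ` the open pro-`Σ` surface-group subgroup of a finite étale Galois covering `Y → X`,
«`U^Σ` is torsion-free» (surface-group model) and «`Z_Δ(U^Σ) = 1`», equivalently (by
`centralizer_eq_bot_iff_mem_of_conj_eq_conj`) «the deck transformations `Gal(Y/X) = Δ/U^Σ` act OUTER-faithfully
on `U^Σ`» (classically: non-trivially on `H₁(U^Σ, ℤ_l)`, Hurwitz/Serre).  Classical group theory; OUR kernel
check; nothing here bears on [IUTchIII] Cor. 3.12.
-/

noncomputable section

open Topology

universe u

namespace Literature.AnabelianGeometry.AbsoluteAnabelian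

open Literature.AlgebraicGeometry.Frobenioids (IsSlimGroup)

variable {G : Type u} [Group G]

/-! ### Pure group theory: finite normal subgroups die against a torsion-free normal subgroup with trivial centraliser -/

/-- A finite subgroup `N` meets a torsion-free subgroup `U` (no nontrivial element of finite order) trivially:
every element of the finite group `N` has finite order. [cite: MochizukiAbsTopI2012, §0 p.8] -/
theorem inf_eq_bot_of_finite_of_forall_isOfFinOrder_eq_one (N U : Subgroup G)
    (hN : (N : Set G).Finite) (hU : ∀ u ∈ U, IsOfFinOrder u → u = 1) : N ⊓ U = ⊥ := by
  haveI : Finite N := hN.to_subtype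
  rw [eq_bot_iff]
  intro x hx
  obtain ⟨hxN, hxU⟩ := Subgroup.mem_inf.mp hx
  have hfin : IsOfFinOrder x := by
    have h := N.subtype.isOfFinOrder (isOfFinOrder_of_finite (⟨x, hxN⟩ : N))
    simpa using h
  exact Subgroup.mem_bot.mpr (hU x hxU hfin)

/-- For NORMAL subgroups `N`, `U` of `G`, the commutator `n u n⁻¹ u⁻¹` of `n ∈ N`, `u ∈ U` lies in `N ⊓ U`
(private helper). [folklore] -/
private theorem mul_mul_inv_mul_inv_mem_inf (N U : Subgroup G) [hN : N.Normal] [hU : U.Normal] {n u : G}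
    (hn : n ∈ N) (hu : u ∈ U) : n * u * n⁻¹ * u⁻¹ ∈ N ⊓ U := by
  refine Subgroup.mem_inf.mpr ⟨?_, ?_⟩
  · -- `n * (u * n⁻¹ * u⁻¹) ∈ N`
    have h : u * n⁻¹ * u⁻¹ ∈ N := hN.conj_mem n⁻¹ (N.inv_mem hn) u
    have : n * u * n⁻¹ * u⁻¹ = n * (u * n⁻¹ * u⁻¹) := by group
    rw [this]
    exact N.mul_mem hn h
  · -- `(n * u * n⁻¹) * u⁻¹ ∈ U`
    exact U.mul_mem (hU.conj_mem u hu n) (U.inv_mem hu)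

/-- **Finite normal subgroups are trivial in the presence of a torsion-free normal subgroup with trivial
centraliser** (abc-iut L4 RULING #7o «P23i-FN-ABSTRACT»; the (β)-half of [AbsTopI] Prop 2.3 (i)'s slimness made
abstract).  Let `U ⊴ G` be torsion-free (no nontrivial element of finite order) with `Z_G(U) = 1`.  Then every
finite normal subgroup `N ⊴ G` is trivial: `N ∩ U = 1` by torsion-freeness, `[N, U] ⊆ N ∩ U = 1` by normality,
so `N ⊆ Z_G(U) = 1`.  Pure group theory (no topology, no openness). [cite: MochizukiAbsTopI2012, §0 p.8] -/
theorem finite_normal_eq_bot_of_torsionFree_of_centralizer_eq_bot (U : Subgroup G) [U.Normal]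
    (hU : ∀ u ∈ U, IsOfFinOrder u → u = 1) (hUc : Subgroup.centralizer (U : Set G) = ⊥) :
    ∀ N : Subgroup G, N.Normal → (N : Set G).Finite → N = ⊥ := by
  intro N hNn hN
  haveI := hNn
  have hNU : N ⊓ U = ⊥ := inf_eq_bot_of_finite_of_forall_isOfFinOrder_eq_one N U hN hU
  rw [eq_bot_iff]
  intro n hn
  have hmem : n ∈ Subgroup.centralizer (U : Set G) := by
    rw [Subgroup.mem_centralizer_iff]
    intro u hu
    have hc : n * u * n⁻¹ * u⁻¹ ∈ N ⊓ U := mul_mul_inv_mul_inv_mem_inf N U hn hu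
    rw [hNU, Subgroup.mem_bot] at hc
    -- `n u n⁻¹ u⁻¹ = 1` ⇒ `n u = u n`
    have h1 : n * u * n⁻¹ = u := mul_inv_eq_one.mp hc
    have h2 : n * u = u * n := mul_inv_eq_iff_eq_mul.mp h1
    exact h2.symm
  rw [hUc] at hmem
  exact hmem

/-- Variant of `finite_normal_eq_bot_of_torsionFree_of_centralizer_eq_bot` with Mathlib's class
`[IsMulTorsionFree U]` (injectivity of `x ↦ x ^ n`, which implies "no nontrivial element of finite order").
[cite: MochizukiAbsTopI2012, §0 p.8] -/
theorem finite_normal_eq_bot_of_torsionFree_of_centralizer_eq_bot' (U : Subgroup G) [U.Normal]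
    [IsMulTorsionFree U] (hUc : Subgroup.centralizer (U : Set G) = ⊥) :
    ∀ N : Subgroup G, N.Normal → (N : Set G).Finite → N = ⊥ := by
  refine finite_normal_eq_bot_of_torsionFree_of_centralizer_eq_bot U (fun u hu hfin => ?_) hUc
  have hfin' : IsOfFinOrder (⟨u, hu⟩ : U) :=
    U.subtype_injective.isOfFinOrder_iff.mp (by simpa using hfin)
  have := hfin'.eq_one'
  simpa using congrArg Subtype.val this

/-! ### The centraliser hypothesis in outer form -/

/-- For a subgroup `U` with trivial centre (`Z_U(U) = 1`, e.g. `U` slim) the hypothesis `Z_G(U) = 1` is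
equivalent to OUTER FAITHFULNESS of the conjugation action: every `g ∈ G` acting on `U` as the inner automorphism
of some `u ∈ U` already lies in `U` (so `G/U ↪ Out(U)` when `U ⊴ G`).  This is the form in which geometric origin
supplies the input for `Δ_X ⊇ U^Σ` (deck transformations act outer-faithfully on the surface group).
[cite: MochizukiAbsTopI2012, Prop 2.3 (i) p.19] -/
theorem centralizer_eq_bot_iff_mem_of_conj_eq_conj (U : Subgroup G)
    (hZ : Subgroup.centralizer ((⊤ : Subgroup U) : Set U) = ⊥) :
    Subgroup.centralizer (U : Set G) = ⊥ ↔
      ∀ g : G, (∃ u ∈ U, ∀ x ∈ U, g * x * g⁻¹ = u * x * u⁻¹) → g ∈ U := by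
  constructor
  · intro hc g ⟨u, hu, hgu⟩
    -- `u⁻¹ g` centralises `U`
    have hmem : u⁻¹ * g ∈ Subgroup.centralizer (U : Set G) := by
      rw [Subgroup.mem_centralizer_iff]
      intro x hx
      have h := hgu x hx
      -- from `g x g⁻¹ = u x u⁻¹` deduce `x (u⁻¹ g) = (u⁻¹ g) x`
      have h' : g * x = u * x * u⁻¹ * g := by
        calc g * x = g * x * g⁻¹ * g := by group
          _ = u * x * u⁻¹ * g := by rw [h]
      calc x * (u⁻¹ * g) = u⁻¹ * (u * x * u⁻¹ * g) := by group
        _ = u⁻¹ * (g * x) := by rw [← h']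
        _ = u⁻¹ * g * x := by group
    rw [hc, Subgroup.mem_bot] at hmem
    have : g = u := by
      calc g = u * (u⁻¹ * g) := by group
        _ = u := by rw [hmem, mul_one]
    rw [this]
    exact hu
  · intro h
    rw [eq_bot_iff]
    intro g hg
    rw [Subgroup.mem_centralizer_iff] at hg
    -- `g` acts on `U` as the identity = conjugation by `1 ∈ U`, so `g ∈ U`
    have hgU : g ∈ U := by
      refine h g ⟨1, U.one_mem, fun x hx => ?_⟩
      rw [one_mul, inv_one, mul_one, ← hg x hx, mul_inv_cancel_right]
    -- and then `g` is central in `U`, hence trivial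
    have hcen : (⟨g, hgU⟩ : U) ∈ Subgroup.centralizer ((⊤ : Subgroup U) : Set U) := by
      rw [Subgroup.mem_centralizer_iff]
      intro x _
      exact Subtype.ext (hg x x.2)
    rw [hZ, Subgroup.mem_bot] at hcen
    exact Subgroup.mem_bot.mpr (congrArg Subtype.val hcen)

/-- A slim group has trivial centre: `Z_U(U) = Z_U(⊤) = 1` (`⊤` is open). [cite: MochizukiAbsTopI2012, §0 p.8] -/
theorem centralizer_top_eq_bot_of_isSlimGroup {U : Type u} [Group U] [TopologicalSpace U] (hU : IsSlimGroup U) :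
    Subgroup.centralizer ((⊤ : Subgroup U) : Set U) = ⊥ :=
  hU.centralizer_eq_bot ⊤ isOpen_univ

/-! ### Corollaries: (FN) replaced by «torsion-free normal subgroup with trivial centraliser» -/

variable [TopologicalSpace G] [IsTopologicalGroup G]

/-- **Slimness ascends** (p433420) with (FN) discharged abstractly: `G` compact, `U ⊆ G` open and slim, and some
NORMAL subgroup `V ⊴ G` torsion-free with `Z_G(V) = 1` (in the application `V = U = U^Σ`) ⇒ `G` slim.
[cite: MochizukiAbsTopI2012, Prop 2.3 (i) p.19] -/
theorem isSlimGroup_of_isOpen_slim_of_torsionFree_of_centralizer_eq_bot [CompactSpace G] (U : Subgroup G)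
    (hUo : IsOpen (U : Set G)) (hUs : IsSlimGroup U) (V : Subgroup G) [V.Normal]
    (hV : ∀ v ∈ V, IsOfFinOrder v → v = 1) (hVc : Subgroup.centralizer (V : Set G) = ⊥) : IsSlimGroup G :=
  isSlimGroup_of_isOpen_slim_of_forall_finite_normal_eq_bot U hUo hUs
    (finite_normal_eq_bot_of_torsionFree_of_centralizer_eq_bot V hV hVc)

/-- **Slim and elastic ascend** (p433420 + p432240) with (FN) discharged abstractly: `G` compact Hausdorff,
`U ⊆ G` open, slim and elastic, `V ⊴ G` torsion-free with `Z_G(V) = 1` ⇒ `G` slim and elastic.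
[cite: MochizukiAbsTopI2012, Prop 2.3 (i) p.19] -/
theorem slim_and_elastic_of_isOpen_of_torsionFree_of_centralizer_eq_bot [CompactSpace G] [T2Space G]
    (U : Subgroup G) (hUo : IsOpen (U : Set G)) (hUs : IsSlimGroup U) (hUe : IsElastic U)
    (V : Subgroup G) [V.Normal] (hV : ∀ v ∈ V, IsOfFinOrder v → v = 1)
    (hVc : Subgroup.centralizer (V : Set G) = ⊥) : IsSlimGroup G ∧ IsElastic G :=
  slim_and_elastic_of_isOpen U hUo hUs hUe (finite_normal_eq_bot_of_torsionFree_of_centralizer_eq_bot V hV hVc)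

/-- The common special case `V = U`: an OPEN NORMAL subgroup `U ⊴ G` of a compact Hausdorff group which is slim,
elastic, torsion-free and has trivial centraliser in `G` (⟺ `G/U` acts outer-faithfully on `U`, by
`centralizer_eq_bot_iff_mem_of_conj_eq_conj`) makes `G` slim and elastic. [cite: MochizukiAbsTopI2012, Prop 2.3 (i) p.19] -/
theorem slim_and_elastic_of_isOpen_normal_torsionFree [CompactSpace G] [T2Space G] (U : Subgroup G) [U.Normal]
    (hUo : IsOpen (U : Set G)) (hUs : IsSlimGroup U) (hUe : IsElastic U)
    (hUt : ∀ u ∈ U, IsOfFinOrder u → u = 1) (hUc : Subgroup.centralizer (U : Set G) = ⊥) :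
    IsSlimGroup G ∧ IsElastic G :=
  slim_and_elastic_of_isOpen_of_torsionFree_of_centralizer_eq_bot U hUo hUs hUe U hUt hUc

namespace FundamentalExtension

/-- Packaged for the node predicate of [AbsTopI] Prop 2.3 (i): if `Δ = E.geom` admits an OPEN subgroup `U` that is
slim and elastic and a NORMAL subgroup `V` that is torsion-free with `Z_Δ(V) = 1` (e.g. `U = V = U^Σ`, the
pro-`Σ` fundamental group of a finite étale Galois covering on which the deck group acts outer-faithfully), then
`E.GeomSlimElastic` — p433420's `geomSlimElastic_of_isOpen_slim_elastic` with (FN) discharged by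
`finite_normal_eq_bot_of_torsionFree_of_centralizer_eq_bot`. [cite: MochizukiAbsTopI2012, Prop 2.3 (i) p.19] -/
theorem geomSlimElastic_of_isOpen_of_torsionFree_of_centralizer_eq_bot (E : FundamentalExtension.{u})
    (U : Subgroup E.geom) (hUo : IsOpen (U : Set E.geom)) (hUs : IsSlimGroup U) (hUe : IsElastic U)
    (V : Subgroup E.geom) [V.Normal] (hV : ∀ v ∈ V, IsOfFinOrder v → v = 1)
    (hVc : Subgroup.centralizer (V : Set E.geom) = ⊥) : E.GeomSlimElastic :=
  geomSlimElastic_of_isOpen_slim_elastic E U hUo hUs hUe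
    (finite_normal_eq_bot_of_torsionFree_of_centralizer_eq_bot V hV hVc)

end FundamentalExtension

end Literature.AnabelianGeometry.AbsoluteAnabelian

end
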